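import Mathlib
import Summits.ValiantsHypothesis.ValiantsHypothesis.Theorems.BarrierLeverPartitionMinorsHitByVPHiddenStatesLowerToAll
import Summits.ValiantsHypothesis.ValiantsHypothesis.Theorems.BarrierLeverPartitionMinorsHitByVPHiddenStatesLowerNode
import Summits.ValiantsHypothesis.ValiantsHypothesis.Theorems.BarrierLeverPartitionMinorsHitByVPHiddenStatesWindowTwenty
import Summits.ValiantsHypothesis.ValiantsHypothesis.Theorems.BarrierLeverPartitionMinorsHitByVPHiddenStatesGradedColexAll

/-!
# Route BarrierLever — item `PartitionMinorsHitByVP` (stmt-ValiantsHypothesis-19717), line `hidden_states`: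
# THE REGISTERED NODE EQUALS THE LOWER NODE; MDS½ ⟺ GC½; every lower cell is a cell of the registered node

Link file (`--supports stmt-ValiantsHypothesis-19717`; cell valiant-natproofs, rung V4, 𝒟-side door (c), registered line
`Cruxes/PartitionMinorsHitByVP/Lines/hidden_states.lean` v8; prover seat val-np-p6 gen 15). Definition-free; closes NO item.
Corollaries of `LowerToAll.good_of_lower` (companion file `…HiddenStatesLowerToAll`: a design good for every injective LOWER row
family is good for every injective row family — translation of the base point = down-compression).

* `body_of_lowerBody` — at every `(h, r)`: the body of `LowerNode.Stmt.universalJoinWideLower` (p599518) implies the body of the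
  REGISTERED `Stmt.stub_universalJoinWide` (= `SymbJoin.Stmt.universalJoinWide`, p588547) with the SAME design and budgets.
* **`universalJoinWide_iff_universalJoinWideLower`** — the registered all-`u` node and the lower node are EQUIVALENT
  (`LowerNode.universalJoinWideLower_of_universalJoinWide` is the other direction).
* **`gcAll_iff_gc`** — conjecture MDS½ (= GC-ALL½, the hypothesis of p647354, typed verbatim) is EQUIVALENT to conjecture GC½ (the
  hypothesis of p636831, typed verbatim); `gc_implies_gcAll` is the new direction (`BallDiag.gcAll_implies_gc` the old one). So the
  conjecture column of the line has ONE entry here, not two: the census of arbitrary injective families adds nothing beyond down-sets.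
* CELLS OF THE REGISTERED NODE (were cells of the lower node only): **`universalJoinWide_upto_nineteen`** — EVERY `(h, r)` with
  `1 ≤ h ≤ 19`, `r ≤ 2^h` (from `CoHub.universalJoinWideLower_upto_nineteen`, p642534; before this file the registered node was open at
  `h = 19`, `289 561 ≤ r ≤ 510 605`, p643643 `allu_window_nineteen`); **`universalJoinWide_twenty_hub`** (`h = 20`, every `r ≤ 547 542`,
  from p646542) and `universalJoinWide_twenty_coTop` (`h = 20`, every `1 032 614 ≤ r ≤ 2^20`); `universalJoinWide_upperHalf_of_gc`
  (GC½ ⇒ the registered node in the whole upper half `r ≥ 2^{h−1}`, one piece, `K = h`). THE FIRST OPEN WINDOW OF THE REGISTERED NODE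
  is therefore `h = 20`, `547 543 ≤ r ≤ 1 032 613` (`CoHub.lower_window_twenty`), the same as the lower node's.

WHAT THIS IS NOT: no new design; GC½ unproved; item 19717 stays OPEN; nothing on crux 14610 or VP ≠ VNP.
-/

set_option linter.dupNamespace false

namespace Summit.ValiantsHypothesis.ValiantsHypothesis.Theorems.BarrierLever.HiddenStates

open Finset

namespace LowerToAll

/-- **Transfer of the body at `(h, r)`**: a legal wide design good for every injective lower row family is good for every injective
row family (same design, same budgets, same thresholds). -/
theorem body_of_lowerBody (h r : ℕ)
    (H : ∃ (m K : ℕ) (W : Fin m → ℕ) (wt : Fin m → Fin K → ℕ) (e : Fin r → Fin m × Finset (Fin K)),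
      m ≤ h + h ∧ K ≤ h * h * h ∧ Function.Injective e ∧
      (∀ x : Fin m × Finset (Fin K), x ∉ Set.range e →
        ∀ i, W (e i).1 + ∑ k ∈ (e i).2, wt (e i).1 k < W x.1 + ∑ k ∈ x.2, wt x.1 k) ∧
      ∀ u : Fin r → Finset (Fin h), Function.Injective u → IsLowerSet (Set.range u) →
        ∃ tx : Fin m → Option (Fin K) → Fin h → ℂ,
          (Matrix.of fun i k : Fin r =>
            ∏ a ∈ u i, (tx (e k).1 none a + ∑ q ∈ (e k).2, tx (e k).1 (some q) a)).det ≠ 0) :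
    ∃ (m K : ℕ) (W : Fin m → ℕ) (wt : Fin m → Fin K → ℕ) (e : Fin r → Fin m × Finset (Fin K)),
      m ≤ h + h ∧ K ≤ h * h * h ∧ Function.Injective e ∧
      (∀ x : Fin m × Finset (Fin K), x ∉ Set.range e →
        ∀ i, W (e i).1 + ∑ k ∈ (e i).2, wt (e i).1 k < W x.1 + ∑ k ∈ x.2, wt x.1 k) ∧
      ∀ u : Fin r → Finset (Fin h), Function.Injective u →
        ∃ tx : Fin m → Option (Fin K) → Fin h → ℂ,
          (Matrix.of fun i k : Fin r =>
            ∏ a ∈ u i, (tx (e k).1 none a + ∑ q ∈ (e k).2, tx (e k).1 (some q) a)).det ≠ 0 := by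
  obtain ⟨m, K, W, wt, e, hm, hK, he, hthr, hgood⟩ := H
  exact ⟨m, K, W, wt, e, hm, hK, he, hthr, fun u hu => good_of_lower e hgood u hu⟩

/-! ## The registered node equals the lower node -/

/-- **The lower node implies the registered all-`u` node** (`SymbJoin.Stmt.universalJoinWide` is the body of
`Stmt.stub_universalJoinWide` verbatim). -/
theorem universalJoinWide_of_universalJoinWideLower (H : LowerNode.Stmt.universalJoinWideLower) :
    SymbJoin.Stmt.universalJoinWide := by
  obtain ⟨h₁, H⟩ := H
  exact ⟨h₁, fun h hh r hr => body_of_lowerBody h r (H h hh r hr)⟩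

/-- **NODE EQUIVALENCE.** The registered all-`u` node and the lower node are equivalent. -/
theorem universalJoinWide_iff_universalJoinWideLower :
    SymbJoin.Stmt.universalJoinWide ↔ LowerNode.Stmt.universalJoinWideLower :=
  ⟨LowerNode.universalJoinWideLower_of_universalJoinWide, universalJoinWide_of_universalJoinWideLower⟩

/-! ## Cells of the registered node -/

/-- **The registered node at every `(h, r)` with `1 ≤ h ≤ 19`, `r ≤ 2^h`.** -/
theorem universalJoinWide_upto_nineteen (h : ℕ) (h1 : 1 ≤ h) (h19 : h ≤ 19) (r : ℕ) (hr : r ≤ 2 ^ h) :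
    ∃ (m K : ℕ) (W : Fin m → ℕ) (wt : Fin m → Fin K → ℕ) (e : Fin r → Fin m × Finset (Fin K)),
      m ≤ h + h ∧ K ≤ h * h * h ∧ Function.Injective e ∧
      (∀ x : Fin m × Finset (Fin K), x ∉ Set.range e →
        ∀ i, W (e i).1 + ∑ k ∈ (e i).2, wt (e i).1 k < W x.1 + ∑ k ∈ x.2, wt x.1 k) ∧
      ∀ u : Fin r → Finset (Fin h), Function.Injective u →
        ∃ tx : Fin m → Option (Fin K) → Fin h → ℂ,
          (Matrix.of fun i k : Fin r =>
            ∏ a ∈ u i, (tx (e k).1 none a + ∑ q ∈ (e k).2, tx (e k).1 (some q) a)).det ≠ 0 :=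
  body_of_lowerBody h r (CoHub.universalJoinWideLower_upto_nineteen h h1 h19 r hr)

/-- **The registered node at `h = 20` for every `r ≤ 547 542`.** -/
theorem universalJoinWide_twenty_hub (r : ℕ) (hr : r ≤ 547542) :
    ∃ (m K : ℕ) (W : Fin m → ℕ) (wt : Fin m → Fin K → ℕ) (e : Fin r → Fin m × Finset (Fin K)),
      m ≤ 20 + 20 ∧ K ≤ 20 * 20 * 20 ∧ Function.Injective e ∧
      (∀ x : Fin m × Finset (Fin K), x ∉ Set.range e →
        ∀ i, W (e i).1 + ∑ k ∈ (e i).2, wt (e i).1 k < W x.1 + ∑ k ∈ x.2, wt x.1 k) ∧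
      ∀ u : Fin r → Finset (Fin 20), Function.Injective u →
        ∃ tx : Fin m → Option (Fin K) → Fin 20 → ℂ,
          (Matrix.of fun i k : Fin r =>
            ∏ a ∈ u i, (tx (e k).1 none a + ∑ q ∈ (e k).2, tx (e k).1 (some q) a)).det ≠ 0 :=
  body_of_lowerBody 20 r (CoHub.universalJoinWideLower_twenty_hub r hr)

/-- **The registered node at `h = 20` for every `1 032 614 ≤ r ≤ 2^20`.** -/
theorem universalJoinWide_twenty_coTop (r : ℕ) (hlo : 1032614 ≤ r) (hr : r ≤ 2 ^ 20) :
    ∃ (m K : ℕ) (W : Fin m → ℕ) (wt : Fin m → Fin K → ℕ) (e : Fin r → Fin m × Finset (Fin K)),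
      m ≤ 20 + 20 ∧ K ≤ 20 * 20 * 20 ∧ Function.Injective e ∧
      (∀ x : Fin m × Finset (Fin K), x ∉ Set.range e →
        ∀ i, W (e i).1 + ∑ k ∈ (e i).2, wt (e i).1 k < W x.1 + ∑ k ∈ x.2, wt x.1 k) ∧
      ∀ u : Fin r → Finset (Fin 20), Function.Injective u →
        ∃ tx : Fin m → Option (Fin K) → Fin 20 → ℂ,
          (Matrix.of fun i k : Fin r =>
            ∏ a ∈ u i, (tx (e k).1 none a + ∑ q ∈ (e k).2, tx (e k).1 (some q) a)).det ≠ 0 :=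
  body_of_lowerBody 20 r (CoHub.universalJoinWideLower_twenty_coTop r hlo hr)

/-- **GC½ ⇒ the REGISTERED node in the whole upper half** (`h ≥ 1`, `2^{h−1} ≤ r ≤ 2^h`; one piece, `K = h`). -/
theorem universalJoinWide_upperHalf_of_gc
    (H : ∀ h r : ℕ, 1 ≤ h → 2 ^ (h - 1) ≤ r → r ≤ 2 ^ h →
      ∀ cols : Fin r → Finset (Fin h), Function.Injective cols →
        (∀ k J, J ∉ Set.range cols → ∑ q ∈ cols k, (2 ^ h + 2 ^ (q : ℕ)) < ∑ q ∈ J, (2 ^ h + 2 ^ (q : ℕ))) →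
        ∀ u : Fin r → Finset (Fin h), Function.Injective u → IsLowerSet (Set.range u) →
          ∃ tx : Option (Fin h) → Fin h → ℂ,
            (Matrix.of fun i k : Fin r => ∏ a ∈ u i, (tx none a + ∑ q ∈ cols k, tx (some q) a)).det ≠ 0)
    (h r : ℕ) (h1 : 1 ≤ h) (hlo : 2 ^ (h - 1) ≤ r) (hhi : r ≤ 2 ^ h) :
    ∃ (m K : ℕ) (W : Fin m → ℕ) (wt : Fin m → Fin K → ℕ) (e : Fin r → Fin m × Finset (Fin K)),
      m ≤ h + h ∧ K ≤ h * h * h ∧ Function.Injective e ∧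
      (∀ x : Fin m × Finset (Fin K), x ∉ Set.range e →
        ∀ i, W (e i).1 + ∑ k ∈ (e i).2, wt (e i).1 k < W x.1 + ∑ k ∈ x.2, wt x.1 k) ∧
      ∀ u : Fin r → Finset (Fin h), Function.Injective u →
        ∃ tx : Fin m → Option (Fin K) → Fin h → ℂ,
          (Matrix.of fun i k : Fin r =>
            ∏ a ∈ u i, (tx (e k).1 none a + ∑ q ∈ (e k).2, tx (e k).1 (some q) a)).det ≠ 0 :=
  body_of_lowerBody h r (BallDiag.universalJoinWideLower_upperHalf_of_gc H h r h1 hlo hhi)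

/-! ## MDS½ ⟺ GC½ -/

/-- **GC½ ⇒ MDS½**: if the graded-colex one-piece family serves every injective LOWER row family (hypothesis of p636831), it serves
every injective row family (hypothesis of p647354) — for every one-piece family `cols`, cell by cell. -/
theorem gc_implies_gcAll
    (H : ∀ h r : ℕ, 1 ≤ h → 2 ^ (h - 1) ≤ r → r ≤ 2 ^ h →
      ∀ cols : Fin r → Finset (Fin h), Function.Injective cols →
        (∀ k J, J ∉ Set.range cols → ∑ q ∈ cols k, (2 ^ h + 2 ^ (q : ℕ)) < ∑ q ∈ J, (2 ^ h + 2 ^ (q : ℕ))) →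
        ∀ u : Fin r → Finset (Fin h), Function.Injective u → IsLowerSet (Set.range u) →
          ∃ tx : Option (Fin h) → Fin h → ℂ,
            (Matrix.of fun i k : Fin r => ∏ a ∈ u i, (tx none a + ∑ q ∈ cols k, tx (some q) a)).det ≠ 0) :
    ∀ h r : ℕ, 1 ≤ h → 2 ^ (h - 1) ≤ r → r ≤ 2 ^ h →
      ∀ cols : Fin r → Finset (Fin h), Function.Injective cols →
        (∀ k J, J ∉ Set.range cols → ∑ q ∈ cols k, (2 ^ h + 2 ^ (q : ℕ)) < ∑ q ∈ J, (2 ^ h + 2 ^ (q : ℕ))) →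
        ∀ u : Fin r → Finset (Fin h), Function.Injective u →
          ∃ tx : Option (Fin h) → Fin h → ℂ,
            (Matrix.of fun i k : Fin r => ∏ a ∈ u i, (tx none a + ∑ q ∈ cols k, tx (some q) a)).det ≠ 0 :=
  fun h r h1 hlo hhi cols hinj hgc u hu =>
    good_of_lower_onePiece cols (fun v hv hl => H h r h1 hlo hhi cols hinj hgc v hv hl) u hu

/-- **MDS½ ⟺ GC½.** -/
theorem gcAll_iff_gc :
    (∀ h r : ℕ, 1 ≤ h → 2 ^ (h - 1) ≤ r → r ≤ 2 ^ h →
      ∀ cols : Fin r → Finset (Fin h), Function.Injective cols →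
        (∀ k J, J ∉ Set.range cols → ∑ q ∈ cols k, (2 ^ h + 2 ^ (q : ℕ)) < ∑ q ∈ J, (2 ^ h + 2 ^ (q : ℕ))) →
        ∀ u : Fin r → Finset (Fin h), Function.Injective u →
          ∃ tx : Option (Fin h) → Fin h → ℂ,
            (Matrix.of fun i k : Fin r => ∏ a ∈ u i, (tx none a + ∑ q ∈ cols k, tx (some q) a)).det ≠ 0) ↔
    (∀ h r : ℕ, 1 ≤ h → 2 ^ (h - 1) ≤ r → r ≤ 2 ^ h →
      ∀ cols : Fin r → Finset (Fin h), Function.Injective cols →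
        (∀ k J, J ∉ Set.range cols → ∑ q ∈ cols k, (2 ^ h + 2 ^ (q : ℕ)) < ∑ q ∈ J, (2 ^ h + 2 ^ (q : ℕ))) →
        ∀ u : Fin r → Finset (Fin h), Function.Injective u → IsLowerSet (Set.range u) →
          ∃ tx : Option (Fin h) → Fin h → ℂ,
            (Matrix.of fun i k : Fin r => ∏ a ∈ u i, (tx none a + ∑ q ∈ cols k, tx (some q) a)).det ≠ 0) :=
  ⟨BallDiag.gcAll_implies_gc, gc_implies_gcAll⟩

/-- **One design at a time** (the form censuses use): a one-piece family `cols` that serves every injective lower row family of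
size `r` serves every injective row family of size `r`. -/
theorem onePiece_all_of_lower {h K r : ℕ} (cols : Fin r → Finset (Fin K))
    (hyp : ∀ v : Fin r → Finset (Fin h), Function.Injective v → IsLowerSet (Set.range v) →
      ∃ tx : Option (Fin K) → Fin h → ℂ,
        (Matrix.of fun i k : Fin r => ∏ c ∈ v i, (tx none c + ∑ q ∈ cols k, tx (some q) c)).det ≠ 0) :
    ∀ u : Fin r → Finset (Fin h), Function.Injective u →
      ∃ tx : Option (Fin K) → Fin h → ℂ,
        (Matrix.of fun i k : Fin r => ∏ c ∈ u i, (tx none c + ∑ q ∈ cols k, tx (some q) c)).det ≠ 0 :=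
  fun u hu => good_of_lower_onePiece cols hyp u hu

end LowerToAll

end Summit.ValiantsHypothesis.ValiantsHypothesis.Theorems.BarrierLever.HiddenStates
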